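import Summits.QuantumFields.BalabanUV.T4Continuum.Spine.NE7.NodeSAtDatumOfRecord
import Summits.QuantumFields.BalabanUV.T4Continuum.Spine.NE7.QLaConeNeighbourhood

/-!
# Spine/NE7/NodeSAtDatumOfRecordNearSupport — the CLOSED-FORM neighbourhood of NODE S's defect bound (file 41) AT NODE 00's datum of
# record (Stage 0): only the large-field bonds within `(d+2)(L^{k+n} − L^k)` finest units of the loop are charged

Cell `pub-balaban-gaps` (YM blitz Y1, track G2, seat `ne7`, generation 13).  48th `Spine/NE7/` file; 0 `def`, 0 sorry; [bookkeeping].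
File 47 §3 gave the cone-local defect bound at `Node00.IsDatumOfRecord₀ F N D` for an ARBITRARY downward-closed cone; this file is its
closed-form twin — file 41's `loopDefect_le_of_near_support` (the canonical cone, centre to centre in the finest lattice, radius
`(d+2)(L^{k+n} − L^{k+i})` at level `k+i`) at `loopDefectBound_of_isDatumOfRecord₀`, with `1 ∈ dom` and the truncation binder discharged
(`truncate_mem_dom`): for every datum of record, cutoff `K`, levels `k + n ≤ m + K`, closed walk `(x, w)` of `T^{(k+n)}`, and level-`k`
configuration `V ∈ dom` trivial off `Λ` with one-bond deviations `≤ Dm`,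
`1 − W(iterFrom (D.av K) k n V)(walk x w) ≤ ½e²·(|w|·|Λ_near|·Dm)²·(θ²)ⁿ`, `Λ_near` = the bonds of `Λ` whose source centre lies within
`ℓ¹`-distance `(d+2)(L^{k+n} − L^k)` of the centre of the source of a step of the loop (file 43 is the same statement for the headline's
class `D.IsPrintedAveraged` on `domPrinted`).  Kept apart from file 47 so that 47 waits only on `Node00.DatumAvLayer`'s olean, this file
also on file 41's.

HONEST FRAMING.  As file 47: Stage 0 constrains only `D.av`; the W-fmt per-entry data stay the object node's (Stage 5).  [bookkeeping];
nothing of Bałaban's asserted; NE7 NOT proved; spine 0∕9; one fixed finite T⁴ — NOT ℝ⁴, NOT infinite volume, NOT a mass gap, NOT Clay.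
-/

noncomputable section

namespace Summit.QuantumFields.BalabanUV.T4Continuum.Spine.NE7

open Literature.MathematicalPhysics.QuantumFieldTheory.Balaban1983to89
open Literature.MathematicalPhysics.QuantumFieldTheory.Balaban1983to89.T4Continuum
open Literature.MathematicalPhysics.QuantumFieldTheory.Balaban1983to89.T4Continuum.FiniteEpsData
open Literature.MathematicalPhysics.QuantumFieldTheory.Balaban1983to89.T4AvgSensitivity
open Literature.MathematicalPhysics.QuantumFieldTheory.Balaban1983to89.T4AvgDerivBound
open Literature.MathematicalPhysics.QuantumFieldTheory.Balaban1983to89.B15DeterminingSets (embIter)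
open Literature.MathematicalPhysics.QuantumFieldTheory.Balaban1983to89.Node00 (IsDatumOfRecord₀)

variable {F : T4Family} {N : ℕ} [NeZero N]

open Classical in
/-- **NODE S's NEAR-SUPPORT DEFECT BOUND AT THE DATUM OF RECORD** (file 41's closed-form cone at `loopDefectBound_of_isDatumOfRecord₀`;
`Λ_near` characterised by `hΛD`). [bookkeeping] -/
theorem loopDefect_le_of_near_support_of_isDatumOfRecord₀ (D : FiniteEpsData F (Matrix.specialUnitaryGroup (Fin N) ℂ))
    (hD : IsDatumOfRecord₀ F N D) (K : ℕ) {k n : ℕ} (hn : k + n ≤ (F.P K).m + (F.P K).K)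
    (x : Site (F.P K) (k + n)) (w : List (Letter (F.P K).d)) (hw : walkEnd x w = x)
    (V : GaugeField (F.P K) k (Matrix.specialUnitaryGroup (Fin N) ℂ)) (hV : V ∈ dom (F.P K) (Fin N) k)
    (Λ ΛD : Finset (PBond (F.P K) k))
    (hΛD : ∀ b, b ∈ ΛD ↔ b ∈ Λ ∧ ∃ s ∈ walk x w,
      Site.tdist (embIter k b.src) (embIter (k + n) s.bond.src)
        ≤ ((F.P K).d + 2) * ((F.P K).L ^ (k + n) - (F.P K).L ^ k))
    (hoff : ∀ b, b ∉ Λ → V b = 1) {Dm : ℝ} (hDm : ∀ b ∈ Λ, dist1 (V b) ≤ Dm) :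
    1 - loopAt (iterFrom (D.av K) k n V) (walk x w)
      ≤ 1 / 2 * Real.exp 1 ^ 2 * ((w.length : ℝ) * ΛD.card * Dm) ^ 2 * (theta (F.P K) ^ 2) ^ n :=
  loopDefect_le_of_near_support (loopDefectBound_of_isDatumOfRecord₀ D hD K) (by positivity) (theta_pos (F.P K)).le hn
    x w hw V (one_mem_dom (n := Fin N) k) Λ ΛD hΛD hoff hDm (truncate_mem_dom hV ΛD)

open Classical in
/-- The same with `Λ_near` THE filtered set (no characterisation hypothesis). [bookkeeping] -/
theorem loopDefect_le_of_near_support_of_isDatumOfRecord₀' (D : FiniteEpsData F (Matrix.specialUnitaryGroup (Fin N) ℂ))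
    (hD : IsDatumOfRecord₀ F N D) (K : ℕ) {k n : ℕ} (hn : k + n ≤ (F.P K).m + (F.P K).K)
    (x : Site (F.P K) (k + n)) (w : List (Letter (F.P K).d)) (hw : walkEnd x w = x)
    (V : GaugeField (F.P K) k (Matrix.specialUnitaryGroup (Fin N) ℂ)) (hV : V ∈ dom (F.P K) (Fin N) k)
    (Λ : Finset (PBond (F.P K) k)) (hoff : ∀ b, b ∉ Λ → V b = 1) {Dm : ℝ} (hDm : ∀ b ∈ Λ, dist1 (V b) ≤ Dm) :
    1 - loopAt (iterFrom (D.av K) k n V) (walk x w)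
      ≤ 1 / 2 * Real.exp 1 ^ 2 * ((w.length : ℝ)
          * (Λ.filter fun b => ∃ s ∈ walk x w, Site.tdist (embIter k b.src) (embIter (k + n) s.bond.src)
              ≤ ((F.P K).d + 2) * ((F.P K).L ^ (k + n) - (F.P K).L ^ k)).card * Dm) ^ 2
        * (theta (F.P K) ^ 2) ^ n :=
  loopDefect_le_of_near_support_of_isDatumOfRecord₀ D hD K hn x w hw V hV Λ _ (fun _ => Finset.mem_filter) hoff hDm

end Summit.QuantumFields.BalabanUV.T4Continuum.Spine.NE7

end
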